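import Summits.BirchSwinnertonDyer.BirchSwinnertonDyer.Theses.GenusKolyvaginAtTwo
import Summits.BirchSwinnertonDyer.BirchSwinnertonDyer.Theorems.GenusKolyvaginAtTwoShaRatCardOfKFour
import Summits.BirchSwinnertonDyer.BirchSwinnertonDyer.Theorems.GenusKolyvaginAtTwoGenusPrimitiveSupplyAtTwoPosDiscShallowKFourPosHalvingDescentCorollaries
import Literature.NumberTheory.EllipticCurves.BSDRootNumberSmallConductorProofs
import HarnessLib

/-!
# LINE 29 «frame_rigidity» — crux K₄⁺ `K4Pos` (stmt-BirchSwinnertonDyer-31469), route `GenusKolyvaginAtTwo`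

Ideator seat `bsd-idea-1` (D-0145), generation 26; technique card «compactness–contradiction / rigidity».  A LINES workfile:
`theorem stub_* … := by sorry` are the REGISTERED STUBS; `K4Pos_of` is the kernel-checked composition concluding the crux BY NAME
(`Summit.BirchSwinnertonDyer.BirchSwinnertonDyer.Theses.GenusKolyvaginAtTwo.K4Pos`) modulo the route item Q2 = `KolyvaginRelationAtTwo`
(stmt-22123, the composition hypothesis of every K₄ currency theorem of the LEAD).  **No summit is proved by a line; BSD is not proved here;
K4Pos is NOT proved here (three `sorry`s).**

## The lever (new on this crux): VARY THE FRAME, not the Kolyvagin prime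

K₄⁺ asks, for a rank-`0` curve `E = W` on the real-narrow `#Sel₂(E) = 4` cell and for EVERY admissible prime frame `K = ℚ(√-ℓ₀)` with Heegner
depth `M₀ = M₀(E, K) ≥ 1` (`2^(M₀) ∥ y_K`), for a transposition-deep Kolyvagin witness `P(n) ∉ 2E(K[n])`.  The LEAD's ★★
`ShaCores.kFourPos_witness_iff_natCard_shaPrimary_rat_eq_pow` (p774xxx, mod Q2 only) says, on the cut: **witness at `K` ⟺ `#Ш(E/ℚ)[2^∞] = 4^(M₀(E,K))`**,
and `exists_addEquiv_shaPrimary_of_kFourPos_cut` gives `#Ш(E/ℚ)[2^∞] = 4^e` with `1 ≤ e ≤ M₀(E, K)` for EVERY frame.  The right-hand side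
`e = e(E)` does NOT depend on the frame.  Hence K₄⁺ at ALL frames ⟺ the depth function `K ↦ M₀(E, K)` is CONSTANT (= `e(E)`) on the admissible
prime frames of `E`.  We split this into two statements neither of which is K₄⁺:

* F1 `stub_frameAttainment` (∃, rank-0 content): the `Ш`-exponent is ATTAINED — given one admissible frame `K₀`, SOME admissible prime frame `K₁`
  of the same `E` has `4^(M₀(E,K₁)) = #Ш(E/ℚ)[2^∞]` (i.e. the minimum of the depth function is `e(E)`; by Gross–Zagier this is `BSD₂(E)` plus
  `BSD₂` of ONE rank-one twin — an existential over infinitely many frames, open to `2^k`-descent certificates per curve and to horizontal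
  (K-aspect) variation of Heegner points);
* F2 `stub_depthRigidity` (∀∀, rank-1 RELATIVE content): two admissible prime frames of the same `E` have the SAME depth, `M₀(E,K₀) = M₀(E,K₁)`
  (by Gross–Zagier at both frames the factor `L(E,1)` CANCELS: F2 ⟺ `ord₂ Ш_an(E^(−ℓ₀)) = ord₂ Ш_an(E^(−ℓ₁))` for two rank-one, `#Sel₂ = 2`,
  `ord₂ C = 0` members of ONE quadratic-twist family — a relative statement about rank-one twins only, implied by `BSD₂` of the twins alone);
* F4 `stub_offCut` (residual): K₄⁺ on the curves with NO odd multiplicative prime (the LEAD's currency theorems need the cut).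

Composition: off the cut → F4; on the cut → F1 gives a frame `K₁` with `#Ш(E/ℚ)[2^∞] = 4^(M₁)`, F2 gives `M₀ = M₁`, ★★ at `K` (`.mpr`) gives the
witness.  The non-trivial automorphism `σ₀` of `K` is produced as in the LEAD's `…KFourCasselsTateCriterion` §4.

CHEAPEST FALSIFIER (F2): two admissible prime frames of ONE cell curve with different exact depths — kit job j340535 (this seat, g26) computes
exact `M₀` for `36963j1` at `ℓ₀ = 11` and `ℓ₀ = 71` (and four more frames); F1 per curve: `2^k`-descent (`#Sel_(2^k)(E/ℚ) = 4^(min k e)`,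
LEAD `…KFourPosSelmerProfile`) against ONE Heegner depth.

References: [Kolyvagin1989Izv] Thm. B₂ · [GrossZagier1986] V §2 (2.2) · [GrossLMS1991] §2 Conj. 2.2, §5 Prop. 5.3 · [McCallumLMS1991] §5 ·
[KrizLi2019] Thm. 1.16, Thm. 5.1 (the only printed `p = 2` transport — along `E[2]`-congruent curves over a FIXED `K`; F2 is transport of the
depth along the FRAME for a fixed `E`, absent from print: corpus+galaxy queries recorded on the line card).
-/

set_option autoImplicit false
set_option linter.dupNamespace false
set_option linter.unusedVariables false

noncomputable section

open scoped Classical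

namespace Summit.BirchSwinnertonDyer.BirchSwinnertonDyer.Cruxes.K4Pos.FrameRigidity

open WeierstrassCurve NumberField IsDedekindDomain Field Literature.NumberTheory.EllipticCurves
  Literature.NumberTheory.GaloisRepresentations Literature.NumberTheory.EllipticCurves.ModularForms
  Literature.NumberTheory.EllipticCurves.RingClassField
open Summit.BirchSwinnertonDyer.BirchSwinnertonDyer.Theses.GenusKolyvaginAtTwo
open Summit.BirchSwinnertonDyer.BirchSwinnertonDyer.Theorems.GenusExact.ShaCores
  (kFourPos_witness_iff_natCard_shaPrimary_rat_eq_pow)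

/-- A quadratic field has a non-trivial `ℚ`-automorphism (the LEAD's recipe, `…KFourCasselsTateCriterion` §4, as a lemma). -/
theorem exists_algEquiv_ne_one (K : Type) [Field K] [NumberField K] (hIQ : IsImaginaryQuadratic K) :
    ∃ τ : K ≃ₐ[ℚ] K, τ ≠ 1 := by
  haveI : Algebra.IsQuadraticExtension ℚ K := ⟨hIQ.1⟩
  have hcard : Nat.card (K ≃ₐ[ℚ] K) = 2 := by rw [IsGalois.card_aut_eq_finrank, hIQ.1]
  by_contra h
  have hsub : Subsingleton (K ≃ₐ[ℚ] K) := ⟨fun a b ↦ by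
    have ha : a = 1 := not_not.mp fun ha ↦ h ⟨a, ha⟩
    have hb : b = 1 := not_not.mp fun hb ↦ h ⟨b, hb⟩
    rw [ha, hb]⟩
  have h1 : Nat.card (K ≃ₐ[ℚ] K) ≤ 1 := Finite.card_le_one_iff_subsingleton.mpr hsub
  omega

/-- **F1 — FRAME ATTAINMENT (stub, rank 2 of the line).**  For `E = W` on the K₄⁺ cell WITH an odd multiplicative prime and an odd-Manin
parametrisation `Dt`, given ONE admissible prime frame `K₀` (all K₄⁺ frame binders), there is an admissible prime frame `K₁` of the same `E`
(same binders, its own datum `d₁`, exact depth `M₁ ≥ 1`, its own `Sel₂`-minimal rank-one twin) at which the depth ATTAINS the `Ш`-exponent: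
`#Ш(E/ℚ)[2^∞] = 4^(M₁)`.  Equivalently (★★) SOME frame carries a transposition-deep witness; equivalently `min_K M₀(E,K) = e(E)`.  (v1.1) Asked only
at DEPTH `M₀ ≥ 2` of the given frame: depth ONE on the cut is the LEAD's THEOREM `PlusDescent.kFourPos_conclusion_of_depth_one_of_hasMultiplicativeReductionAt`
(item 33819 `K4PosDepthOneOnCut`), consumed by name in the composition.
Why it might fail: only with BSD₂ (for `E` or for every rank-one prime twin in the cell).  Why easier than K₄⁺: existential over infinitely many
frames — BUT (critic #504 P1, BOOKED): through the GZ ledger F1 ⟺ `∃ ℓ₁ : ord₂ Ш_an(E) + ord₂ Ш_an(E^(−ℓ₁)) + κ ≤ 2e`, an inequality in the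
L-VALUE (Skinner–Urban) direction whose `E`-terms are FRAME-FREE; once any unit twin is in hand (F2Z) it reads `ord₂ Ш_an(E) + κ ≤ 2e` = the rank-`0`
`2`-part SU-inequality for the `#Sel₂ = 4` cell curve `E` itself — the SAME WALL as LINE 30-A on the other cell («rank-0 SU-direction 2-inequality for E
(wall); mechanism wanted»); the ∃ over frames does NOT soften it (equidistribution moves `y_K`, not `ord₂ Ш_an(E)`).
[cite: Kolyvagin1989Izv, Thm. B₂] [cite: GrossLMS1991, §2 Conj. 2.2] -/
theorem stub_frameAttainment
    (W : WeierstrassCurve ℚ) [W.IsElliptic] [W.IsGloballyMinimal] [NeZero (W.conductorNorm ℤ)]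
    (hcm : ¬ W.HasCM) (hr0 : W.analyticRank = 0) (hρ : ∀ n : ℕ, 0 < n → W.HasSurjectiveModNGaloisRep ((2 : ℤ) ^ n))
    (hT : Odd W.tamagawaProduct) (hpos : 0 < W.Δ)
    (h4 : Nat.card (W.selmerGroup 2) = 4 ∧ ∃ c ∈ (W.kummerSelmerStructure ((2 : ℕ) : ℤ)).selmerGroup,
      galoisCohomology.localization (W.torsionGaloisModule ((2 : ℕ) : ℤ)) (Sum.inl Rat.infinitePlace) 1 c ≠ 0)
    (v : HeightOneSpectrum (𝓞 ℚ)) (h2v : ((2 : ℕ) : 𝓞 ℚ) ∉ v.asIdeal)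
    (hNv : ((W.conductorNorm ℤ : ℕ) : 𝓞 ℚ) ∈ v.asIdeal) (hmult : W.HasMultiplicativeReductionAt v)
    (K₀ : Type) [Field K₀] [NumberField K₀] (hIQ₀ : IsImaginaryQuadratic K₀) (hodd₀ : Odd (NumberField.discr K₀))
    (h3₀ : NumberField.discr K₀ ≠ -3) (hHe₀ : SatisfiesHeegnerHypothesis (W.conductorNorm ℤ) K₀)
    (hsq1₀ : ¬ IsSquare ((NumberField.discr K₀ : ℚ) * -|W.Δ|)) (hsq2₀ : ¬ IsSquare ((NumberField.discr K₀ : ℚ) * (-(2 * |W.Δ|))))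
    (ℓ₀ : ℕ) (hℓ₀ : ℓ₀.Prime) (hdK₀ : NumberField.discr K₀ = -(ℓ₀ : ℤ))
    (h2K₀ : ((Ideal.span {(2 : ℤ)}).primesOver (𝓞 K₀)).ncard = 2)
    (Dt : ModularParametrizationData W (W.conductorNorm ℤ))
    (hopt : ∀ z ∈ Dt.L.lattice, ∃ w ∈ periodLattice Dt.f, z = (Dt.c : ℂ) * w) (hc : Odd Dt.c)
    (β₀ : ℤ) (ι₀ : K₀ →+* ℂ) (d₀ : KolyvaginHeegnerData Dt β₀ ι₀ 1) (hy₀ : ¬ IsOfFinAddOrder d₀.derivedPoint)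
    (M₀ : ℕ) (hdiv₀ : ∃ Q : (W.baseChange (ringClassField K₀ ι₀ 1)).toAffine.Point, ((2 ^ M₀ : ℕ) : ℤ) • Q = d₀.derivedPoint)
    (hndiv₀ : ¬ ∃ Q : (W.baseChange (ringClassField K₀ ι₀ 1)).toAffine.Point, ((2 ^ (M₀ + 1) : ℕ) : ℤ) • Q = d₀.derivedPoint)
    (hM₀ : 1 ≤ M₀) (hM₀2 : 2 ≤ M₀)
    (Wd₀ : WeierstrassCurve ℚ) [Wd₀.IsElliptic] [Wd₀.IsGloballyMinimal]
    (hWd₀ : ∃ C : VariableChange ℚ, C • W.quadraticTwist (NumberField.discr K₀ : ℚ) = Wd₀)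
    (hrd₀ : Wd₀.analyticRank = 1) (hSel₀ : Nat.card (Wd₀.selmerGroup 2) = 2) (hDEF₀ : padicValNat 2 Wd₀.tamagawaProduct = 0) :
    ∃ (K₁ : Type) (_ : Field K₁) (_ : NumberField K₁),
      IsImaginaryQuadratic K₁ ∧ Odd (NumberField.discr K₁) ∧ NumberField.discr K₁ ≠ -3 ∧
      SatisfiesHeegnerHypothesis (W.conductorNorm ℤ) K₁ ∧
      ¬ IsSquare ((NumberField.discr K₁ : ℚ) * -|W.Δ|) ∧ ¬ IsSquare ((NumberField.discr K₁ : ℚ) * (-(2 * |W.Δ|))) ∧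
      ∃ (ℓ₁ : ℕ), ℓ₁.Prime ∧ NumberField.discr K₁ = -(ℓ₁ : ℤ) ∧ ((Ideal.span {(2 : ℤ)}).primesOver (𝓞 K₁)).ncard = 2 ∧
      ∃ (β₁ : ℤ) (ι₁ : K₁ →+* ℂ) (d₁ : KolyvaginHeegnerData Dt β₁ ι₁ 1), ¬ IsOfFinAddOrder d₁.derivedPoint ∧
      ∃ (M₁ : ℕ), (∃ Q : (W.baseChange (ringClassField K₁ ι₁ 1)).toAffine.Point, ((2 ^ M₁ : ℕ) : ℤ) • Q = d₁.derivedPoint) ∧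
        (¬ ∃ Q : (W.baseChange (ringClassField K₁ ι₁ 1)).toAffine.Point, ((2 ^ (M₁ + 1) : ℕ) : ℤ) • Q = d₁.derivedPoint) ∧ 1 ≤ M₁ ∧
        (∃ (Wd₁ : WeierstrassCurve ℚ) (_ : Wd₁.IsElliptic) (_ : Wd₁.IsGloballyMinimal),
          (∃ C : VariableChange ℚ, C • W.quadraticTwist (NumberField.discr K₁ : ℚ) = Wd₁) ∧ Wd₁.analyticRank = 1 ∧
          Nat.card (Wd₁.selmerGroup 2) = 2 ∧ padicValNat 2 Wd₁.tamagawaProduct = 0) ∧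
        Nat.card (AddCommGroup.primaryComponent (↥W.sha) 2) = 4 ^ M₁ := by
  sorry

/-! ### F2 — DEPTH RIGIDITY ACROSS PRIME FRAMES, v1.2: DERIVED from F2T (transport, typed) + F2Z (unit-twin supply, OPEN ∃) + F2L (two-frame ledger, print-shaped)

F2 («two admissible prime frames of a cut-cell curve have the same exact Heegner depth `M₀ = M₁`») is, by Gross–Zagier at both frames
(`L(E,1)`, `Ш_an(E)`, the Manin constant, `C(E)`, the period sign factor all CANCEL — they depend on `E` only), the statement
`ord₂ Ш_an(E^(−ℓ₀))·C(E^(−ℓ₀)) = ord₂ Ш_an(E^(−ℓ₁))·C(E^(−ℓ₁))` (F2L).  The congruence `E^(−ℓ₀)[2] ≅ E[2] ≅ E^(−ℓ₁)[2]` is EXACTLY mod `2`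
and NOT mod `4` (the `E[4]`'s differ by the quadratic character of `ℚ(√(ℓ₀ℓ₁))`), so Kriz–Li-type transport between the twins sees only the
UNIT LAYER «`ord₂ Ш_an = 0` vs `> 0`» (F2T) — which suffices ONLY because `BSD₂` predicts `0` for every `Sel₂`-minimal rank-one twin
(`Ш(Wd)[2] = 0`); any regime where the common value is `> 0` is out of reach of transport by construction.  The anchor «SOME admissible twin of
`E` has unit `Ш_an`» (F2Z) is Kriz–Li's horizontal SHAPE but NOT their theorem: [KrizLi2019, Thm. 5.1] is RELATIVE (it transports `BSD(2)` from
a numerically verified base pair `(E, E^(d_K))`), so F2Z is OPEN as a ∀-cell statement (per fixed `E` it is a finite computation). -/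

/-- **F2T — TWIN-TO-TWIN UNIT-LAYER TRANSPORT (stub, rank 1: the line's first lemma, TYPED per critic #504 P2).**  For `E = W` on the K₄⁺ cut
cell and two admissible prime frames `K₀ = ℚ(√−ℓ₀)`, `K₁ = ℚ(√−ℓ₁)` (field binders of K₄⁺; their `Sel₂`-minimal rank-one twins `Wd₀ ≅ E^(−ℓ₀)`,
`Wd₁ ≅ E^(−ℓ₁)` with `ord₂ C = 0`; NO Heegner datum): `ord₂ Ш_an(Wd₀) = 0 ⟺ ord₂ Ш_an(Wd₁) = 0`.
Mechanism (named, not proved): at a COMMON auxiliary frame `K′` (imaginary quadratic, `2` split, Heegner for `N·ℓ₀²` and `N·ℓ₁²`, Kriz–Li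
Assumption (★) for `Wd₀`), the mod-`2` log-congruence [KrizLi2019, Thm. 1.16] between the Heegner points of `Wd₀` and `Wd₁ = Wd₀^(ℓ₀ℓ₁)`
(`Wd₀[2] ≅ Wd₁[2]`, both `S₃`) transports (★), hence `2`-indivisibility of `P′` [Lemma 5.4, Cor. 5.5], hence — with Zhai's modular-symbol
formula for the rank-`0` `K′`-partners [Thm. 5.1 (2), §5.3] — the unit layer of `Ш_an` over `ℚ`.  FACTS TO RESPECT: (a) the congruence is mod `2`,
not mod `4` — F2T is a statement about the unit layer only; (b) Kriz–Li's side conditions (`E(ℚ)[2] = 0` ✓ from `ρ̄₂` onto; `c₂` odd ✓ from `C` odd;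
`2` split in `K′`; `ψ_d(−N) = 1` for `d = ℓ₀ℓ₁`) must be MET by a common `K′` — its existence for every pair of admissible frames is part of the stub.
Why it might fail: no common (★)-frame `K′` for some pair (then transport has no anchor), or the `ψ_(ℓ₀ℓ₁)(−N) = 1` side condition excludes
half the pairs — instrument: Kriz–Li Table-1 recipe on two admissible frames of one cell curve.  NOT implied by K₄⁺ (no datum, no depth) and
does not imply it.  [cite: KrizLi2019, Thm. 1.16, Thm. 5.1, Lemma 5.4, Cor. 5.5] [cite: Zhai2016, Thm. 1.1] -/
theorem stub_twinTransport
    (W : WeierstrassCurve ℚ) [W.IsElliptic] [W.IsGloballyMinimal] [NeZero (W.conductorNorm ℤ)]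
    (hcm : ¬ W.HasCM) (hr0 : W.analyticRank = 0) (hρ : ∀ n : ℕ, 0 < n → W.HasSurjectiveModNGaloisRep ((2 : ℤ) ^ n))
    (hT : Odd W.tamagawaProduct) (hpos : 0 < W.Δ)
    (h4 : Nat.card (W.selmerGroup 2) = 4 ∧ ∃ c ∈ (W.kummerSelmerStructure ((2 : ℕ) : ℤ)).selmerGroup,
      galoisCohomology.localization (W.torsionGaloisModule ((2 : ℕ) : ℤ)) (Sum.inl Rat.infinitePlace) 1 c ≠ 0)
    (v : HeightOneSpectrum (𝓞 ℚ)) (h2v : ((2 : ℕ) : 𝓞 ℚ) ∉ v.asIdeal)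
    (hNv : ((W.conductorNorm ℤ : ℕ) : 𝓞 ℚ) ∈ v.asIdeal) (hmult : W.HasMultiplicativeReductionAt v)
    (K₀ : Type) [Field K₀] [NumberField K₀] (hIQ₀ : IsImaginaryQuadratic K₀) (hodd₀ : Odd (NumberField.discr K₀))
    (h3₀ : NumberField.discr K₀ ≠ -3) (hHe₀ : SatisfiesHeegnerHypothesis (W.conductorNorm ℤ) K₀)
    (hsq1₀ : ¬ IsSquare ((NumberField.discr K₀ : ℚ) * -|W.Δ|)) (hsq2₀ : ¬ IsSquare ((NumberField.discr K₀ : ℚ) * (-(2 * |W.Δ|))))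
    (ℓ₀ : ℕ) (hℓ₀ : ℓ₀.Prime) (hdK₀ : NumberField.discr K₀ = -(ℓ₀ : ℤ))
    (h2K₀ : ((Ideal.span {(2 : ℤ)}).primesOver (𝓞 K₀)).ncard = 2)
    (Wd₀ : WeierstrassCurve ℚ) [Wd₀.IsElliptic] [Wd₀.IsGloballyMinimal]
    (hWd₀ : ∃ C : VariableChange ℚ, C • W.quadraticTwist (NumberField.discr K₀ : ℚ) = Wd₀)
    (hrd₀ : Wd₀.analyticRank = 1) (hSel₀ : Nat.card (Wd₀.selmerGroup 2) = 2) (hDEF₀ : padicValNat 2 Wd₀.tamagawaProduct = 0)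
    (K₁ : Type) [Field K₁] [NumberField K₁] (hIQ₁ : IsImaginaryQuadratic K₁) (hodd₁ : Odd (NumberField.discr K₁))
    (h3₁ : NumberField.discr K₁ ≠ -3) (hHe₁ : SatisfiesHeegnerHypothesis (W.conductorNorm ℤ) K₁)
    (hsq1₁ : ¬ IsSquare ((NumberField.discr K₁ : ℚ) * -|W.Δ|)) (hsq2₁ : ¬ IsSquare ((NumberField.discr K₁ : ℚ) * (-(2 * |W.Δ|))))
    (ℓ₁ : ℕ) (hℓ₁ : ℓ₁.Prime) (hdK₁ : NumberField.discr K₁ = -(ℓ₁ : ℤ))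
    (h2K₁ : ((Ideal.span {(2 : ℤ)}).primesOver (𝓞 K₁)).ncard = 2)
    (Wd₁ : WeierstrassCurve ℚ) [Wd₁.IsElliptic] [Wd₁.IsGloballyMinimal]
    (hWd₁ : ∃ C : VariableChange ℚ, C • W.quadraticTwist (NumberField.discr K₁ : ℚ) = Wd₁)
    (hrd₁ : Wd₁.analyticRank = 1) (hSel₁ : Nat.card (Wd₁.selmerGroup 2) = 2) (hDEF₁ : padicValNat 2 Wd₁.tamagawaProduct = 0) :
    (∃ q : ℚ, shaAn Wd₀ = (q : ℂ) ∧ padicValRat 2 q = 0) ↔ (∃ q : ℚ, shaAn Wd₁ = (q : ℂ) ∧ padicValRat 2 q = 0) := by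
  sorry

/-- **F2Z — UNIT-TWIN SUPPLY (stub, rank 2; an OPEN existential, Kriz–Li's horizontal SHAPE, not their theorem).**  Every K₄⁺ cut-cell curve
`E = W` has at least ONE admissible prime frame `K_z = ℚ(√−ℓ_z)` (K₄⁺ field binders) whose `Sel₂`-minimal rank-one twin `Wd_z ≅ E^(−ℓ_z)`
(`ord₂ C = 0`) has `2`-adic UNIT analytic Sha: `ord₂ Ш_an(Wd_z) = 0`.  Why plausibly true: `BSD₂(Wd_z)` predicts it at EVERY admissible frame
(`#Sel₂ = 2 = 2^rank` ⟹ `Ш(Wd_z)[2] = 0`); it is the rank-one `2`-part of BSD for ONE twist per curve.  Why beyond print: [KrizLi2019, Thm. 5.1]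
gives it only RELATIVE to a numerically verified anchor pair `(E, E^(d_K))` at a (★)-frame (per fixed `E` a finite computation — Remark 5.2 —
not a theorem over the cell); no `p = 2` rank-one converse/BSD formula is in print for `ρ̄₂` onto (Cai–Li–Zhai / Shu–Zhai need `E(ℚ)[2] ≠ 0`).
Why it might fail: only with BSD₂ for every admissible twin of some cell curve.  [cite: KrizLi2019, Thm. 5.1, Rem. 5.2] [cite: GrossLMS1991, §2 Conj. 2.2] -/
theorem stub_unitTwinSupply
    (W : WeierstrassCurve ℚ) [W.IsElliptic] [W.IsGloballyMinimal] [NeZero (W.conductorNorm ℤ)]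
    (hcm : ¬ W.HasCM) (hr0 : W.analyticRank = 0) (hρ : ∀ n : ℕ, 0 < n → W.HasSurjectiveModNGaloisRep ((2 : ℤ) ^ n))
    (hT : Odd W.tamagawaProduct) (hpos : 0 < W.Δ)
    (h4 : Nat.card (W.selmerGroup 2) = 4 ∧ ∃ c ∈ (W.kummerSelmerStructure ((2 : ℕ) : ℤ)).selmerGroup,
      galoisCohomology.localization (W.torsionGaloisModule ((2 : ℕ) : ℤ)) (Sum.inl Rat.infinitePlace) 1 c ≠ 0)
    (v : HeightOneSpectrum (𝓞 ℚ)) (h2v : ((2 : ℕ) : 𝓞 ℚ) ∉ v.asIdeal)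
    (hNv : ((W.conductorNorm ℤ : ℕ) : 𝓞 ℚ) ∈ v.asIdeal) (hmult : W.HasMultiplicativeReductionAt v) :
    ∃ (K₁ : Type) (_ : Field K₁) (_ : NumberField K₁),
      IsImaginaryQuadratic K₁ ∧ Odd (NumberField.discr K₁) ∧ NumberField.discr K₁ ≠ -3 ∧
      SatisfiesHeegnerHypothesis (W.conductorNorm ℤ) K₁ ∧
      ¬ IsSquare ((NumberField.discr K₁ : ℚ) * -|W.Δ|) ∧ ¬ IsSquare ((NumberField.discr K₁ : ℚ) * (-(2 * |W.Δ|))) ∧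
      ∃ (ℓ₁ : ℕ), ℓ₁.Prime ∧ NumberField.discr K₁ = -(ℓ₁ : ℤ) ∧ ((Ideal.span {(2 : ℤ)}).primesOver (𝓞 K₁)).ncard = 2 ∧
      ∃ (Wd₁ : WeierstrassCurve ℚ) (_ : Wd₁.IsElliptic) (_ : Wd₁.IsGloballyMinimal),
        (∃ C : VariableChange ℚ, C • W.quadraticTwist (NumberField.discr K₁ : ℚ) = Wd₁) ∧ Wd₁.analyticRank = 1 ∧
        Nat.card (Wd₁.selmerGroup 2) = 2 ∧ padicValNat 2 Wd₁.tamagawaProduct = 0 ∧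
        ∃ q : ℚ, shaAn Wd₁ = (q : ℂ) ∧ padicValRat 2 q = 0 := by
  sorry

/-- **F2L — THE TWO-FRAME GROSS–ZAGIER LEDGER (stub, rank 5; PRINT-shaped bookkeeping, modulo the route's four print items).**  For `E = W` on
the K₄⁺ cell with an odd-Manin parametrisation `Dt` and two admissible prime frames WITH Heegner data (exact depths `M₀`, `M₁`): Gross–Zagier V (2.2)
at both frames (`u_K = 1`, `c` odd, `h_K` odd), `[E(K_i) : ℤ y_i]₂ = 2^(M_i)` (no `2`-torsion, `E(K_i) ⊗ ℤ₂` of rank one), and the quotient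
relation `Ш_an(E/K_i) ≐ Ш_an(E)·Ш_an(E^(−ℓ_i))·(period/Tamagawa ratio depending on E only)` give, on subtracting the two frames,
**`2·M₀ − 2·M₁ = (ord₂ Ш_an(Wd₀) + ord₂ C(Wd₀)) − (ord₂ Ш_an(Wd₁) + ord₂ C(Wd₁))`** — every `E`-term cancels.  Why it might fail: it is print-level;
a frame-DEPENDENT `2`-power in the period ratio `Ω(E/K_i)/(Ω(E)·Ω(E^(−ℓ_i)))` or in `c_(ℓ_i)(E^(−ℓ_i))` not captured by `C(Wd_i)` would appear as an
offset — the LEAD's single-frame currency theorems (`padicValRat_shaAnOverC_heegnerC`, `shaExactC_of_bsdp_at`, ★★) are the template and fix the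
conventions.  [cite: GrossZagier1986, V §2 (2.2)] [cite: GrossLMS1991, §2 (2.4), §5 Prop. 5.3] [cite: Milne1972ArithmeticAV, §1 Thm. 1] -/
theorem stub_twoFrameLedger (hGZ : GrossZagierAllLevels) (hGZK : MultPublishedInputsAtTwo) (hL : EntireLFunctionRat) (hMi : MilneAnyModel)
    (W : WeierstrassCurve ℚ) [W.IsElliptic] [W.IsGloballyMinimal] [NeZero (W.conductorNorm ℤ)]
    (hcm : ¬ W.HasCM) (hr0 : W.analyticRank = 0) (hρ : ∀ n : ℕ, 0 < n → W.HasSurjectiveModNGaloisRep ((2 : ℤ) ^ n))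
    (hT : Odd W.tamagawaProduct) (hpos : 0 < W.Δ)
    (h4 : Nat.card (W.selmerGroup 2) = 4 ∧ ∃ c ∈ (W.kummerSelmerStructure ((2 : ℕ) : ℤ)).selmerGroup,
      galoisCohomology.localization (W.torsionGaloisModule ((2 : ℕ) : ℤ)) (Sum.inl Rat.infinitePlace) 1 c ≠ 0)
    (Dt : ModularParametrizationData W (W.conductorNorm ℤ))
    (hopt : ∀ z ∈ Dt.L.lattice, ∃ w ∈ periodLattice Dt.f, z = (Dt.c : ℂ) * w) (hc : Odd Dt.c)
    (K₀ : Type) [Field K₀] [NumberField K₀] (hIQ₀ : IsImaginaryQuadratic K₀) (hodd₀ : Odd (NumberField.discr K₀))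
    (h3₀ : NumberField.discr K₀ ≠ -3) (hHe₀ : SatisfiesHeegnerHypothesis (W.conductorNorm ℤ) K₀)
    (hsq1₀ : ¬ IsSquare ((NumberField.discr K₀ : ℚ) * -|W.Δ|)) (hsq2₀ : ¬ IsSquare ((NumberField.discr K₀ : ℚ) * (-(2 * |W.Δ|))))
    (ℓ₀ : ℕ) (hℓ₀ : ℓ₀.Prime) (hdK₀ : NumberField.discr K₀ = -(ℓ₀ : ℤ))
    (h2K₀ : ((Ideal.span {(2 : ℤ)}).primesOver (𝓞 K₀)).ncard = 2)
    (β₀ : ℤ) (ι₀ : K₀ →+* ℂ) (d₀ : KolyvaginHeegnerData Dt β₀ ι₀ 1) (hy₀ : ¬ IsOfFinAddOrder d₀.derivedPoint)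
    (M₀ : ℕ) (hdiv₀ : ∃ Q : (W.baseChange (ringClassField K₀ ι₀ 1)).toAffine.Point, ((2 ^ M₀ : ℕ) : ℤ) • Q = d₀.derivedPoint)
    (hndiv₀ : ¬ ∃ Q : (W.baseChange (ringClassField K₀ ι₀ 1)).toAffine.Point, ((2 ^ (M₀ + 1) : ℕ) : ℤ) • Q = d₀.derivedPoint)
    (hM₀ : 1 ≤ M₀)
    (Wd₀ : WeierstrassCurve ℚ) [Wd₀.IsElliptic] [Wd₀.IsGloballyMinimal]
    (hWd₀ : ∃ C : VariableChange ℚ, C • W.quadraticTwist (NumberField.discr K₀ : ℚ) = Wd₀)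
    (hrd₀ : Wd₀.analyticRank = 1) (hSel₀ : Nat.card (Wd₀.selmerGroup 2) = 2) (hDEF₀ : padicValNat 2 Wd₀.tamagawaProduct = 0)
    (K₁ : Type) [Field K₁] [NumberField K₁] (hIQ₁ : IsImaginaryQuadratic K₁) (hodd₁ : Odd (NumberField.discr K₁))
    (h3₁ : NumberField.discr K₁ ≠ -3) (hHe₁ : SatisfiesHeegnerHypothesis (W.conductorNorm ℤ) K₁)
    (hsq1₁ : ¬ IsSquare ((NumberField.discr K₁ : ℚ) * -|W.Δ|)) (hsq2₁ : ¬ IsSquare ((NumberField.discr K₁ : ℚ) * (-(2 * |W.Δ|))))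
    (ℓ₁ : ℕ) (hℓ₁ : ℓ₁.Prime) (hdK₁ : NumberField.discr K₁ = -(ℓ₁ : ℤ))
    (h2K₁ : ((Ideal.span {(2 : ℤ)}).primesOver (𝓞 K₁)).ncard = 2)
    (β₁ : ℤ) (ι₁ : K₁ →+* ℂ) (d₁ : KolyvaginHeegnerData Dt β₁ ι₁ 1) (hy₁ : ¬ IsOfFinAddOrder d₁.derivedPoint)
    (M₁ : ℕ) (hdiv₁ : ∃ Q : (W.baseChange (ringClassField K₁ ι₁ 1)).toAffine.Point, ((2 ^ M₁ : ℕ) : ℤ) • Q = d₁.derivedPoint)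
    (hndiv₁ : ¬ ∃ Q : (W.baseChange (ringClassField K₁ ι₁ 1)).toAffine.Point, ((2 ^ (M₁ + 1) : ℕ) : ℤ) • Q = d₁.derivedPoint)
    (hM₁ : 1 ≤ M₁)
    (Wd₁ : WeierstrassCurve ℚ) [Wd₁.IsElliptic] [Wd₁.IsGloballyMinimal]
    (hWd₁ : ∃ C : VariableChange ℚ, C • W.quadraticTwist (NumberField.discr K₁ : ℚ) = Wd₁)
    (hrd₁ : Wd₁.analyticRank = 1) (hSel₁ : Nat.card (Wd₁.selmerGroup 2) = 2) (hDEF₁ : padicValNat 2 Wd₁.tamagawaProduct = 0)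
    (q₀ q₁ : ℚ) (hq₀ : shaAn Wd₀ = (q₀ : ℂ)) (hq₁ : shaAn Wd₁ = (q₁ : ℂ)) :
    2 * (M₀ : ℤ) - 2 * (M₁ : ℤ) =
      (padicValRat 2 q₀ + (padicValNat 2 Wd₀.tamagawaProduct : ℤ)) - (padicValRat 2 q₁ + (padicValNat 2 Wd₁.tamagawaProduct : ℤ)) := by
  sorry

/-- **F2 DERIVED (no `sorry` of its own): F2T → F2Z → F2L → depth rigidity `M₀ = M₁`** for two admissible prime frames of a cut-cell curve
(the first at depth `≥ 2`, as the composition needs it), modulo the four print items.  Unit layer at the anchor frame (F2Z) is transported to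
both given frames (F2T twice); the ledger (F2L) then reads `2·M₀ − 2·M₁ = 0`. -/
theorem depthRigidity_of_transport (hGZ : GrossZagierAllLevels) (hGZK : MultPublishedInputsAtTwo) (hL : EntireLFunctionRat)
    (hMi : MilneAnyModel)
    (W : WeierstrassCurve ℚ) [W.IsElliptic] [W.IsGloballyMinimal] [NeZero (W.conductorNorm ℤ)]
    (hcm : ¬ W.HasCM) (hr0 : W.analyticRank = 0) (hρ : ∀ n : ℕ, 0 < n → W.HasSurjectiveModNGaloisRep ((2 : ℤ) ^ n))
    (hT : Odd W.tamagawaProduct) (hpos : 0 < W.Δ)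
    (h4 : Nat.card (W.selmerGroup 2) = 4 ∧ ∃ c ∈ (W.kummerSelmerStructure ((2 : ℕ) : ℤ)).selmerGroup,
      galoisCohomology.localization (W.torsionGaloisModule ((2 : ℕ) : ℤ)) (Sum.inl Rat.infinitePlace) 1 c ≠ 0)
    (v : HeightOneSpectrum (𝓞 ℚ)) (h2v : ((2 : ℕ) : 𝓞 ℚ) ∉ v.asIdeal)
    (hNv : ((W.conductorNorm ℤ : ℕ) : 𝓞 ℚ) ∈ v.asIdeal) (hmult : W.HasMultiplicativeReductionAt v)
    (Dt : ModularParametrizationData W (W.conductorNorm ℤ))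
    (hopt : ∀ z ∈ Dt.L.lattice, ∃ w ∈ periodLattice Dt.f, z = (Dt.c : ℂ) * w) (hc : Odd Dt.c)
    (K₀ : Type) [Field K₀] [NumberField K₀] (hIQ₀ : IsImaginaryQuadratic K₀) (hodd₀ : Odd (NumberField.discr K₀))
    (h3₀ : NumberField.discr K₀ ≠ -3) (hHe₀ : SatisfiesHeegnerHypothesis (W.conductorNorm ℤ) K₀)
    (hsq1₀ : ¬ IsSquare ((NumberField.discr K₀ : ℚ) * -|W.Δ|)) (hsq2₀ : ¬ IsSquare ((NumberField.discr K₀ : ℚ) * (-(2 * |W.Δ|))))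
    (ℓ₀ : ℕ) (hℓ₀ : ℓ₀.Prime) (hdK₀ : NumberField.discr K₀ = -(ℓ₀ : ℤ))
    (h2K₀ : ((Ideal.span {(2 : ℤ)}).primesOver (𝓞 K₀)).ncard = 2)
    (β₀ : ℤ) (ι₀ : K₀ →+* ℂ) (d₀ : KolyvaginHeegnerData Dt β₀ ι₀ 1) (hy₀ : ¬ IsOfFinAddOrder d₀.derivedPoint)
    (M₀ : ℕ) (hdiv₀ : ∃ Q : (W.baseChange (ringClassField K₀ ι₀ 1)).toAffine.Point, ((2 ^ M₀ : ℕ) : ℤ) • Q = d₀.derivedPoint)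
    (hndiv₀ : ¬ ∃ Q : (W.baseChange (ringClassField K₀ ι₀ 1)).toAffine.Point, ((2 ^ (M₀ + 1) : ℕ) : ℤ) • Q = d₀.derivedPoint)
    (hM₀ : 1 ≤ M₀) (hM₀2 : 2 ≤ M₀)
    (Wd₀ : WeierstrassCurve ℚ) [Wd₀.IsElliptic] [Wd₀.IsGloballyMinimal]
    (hWd₀ : ∃ C : VariableChange ℚ, C • W.quadraticTwist (NumberField.discr K₀ : ℚ) = Wd₀)
    (hrd₀ : Wd₀.analyticRank = 1) (hSel₀ : Nat.card (Wd₀.selmerGroup 2) = 2) (hDEF₀ : padicValNat 2 Wd₀.tamagawaProduct = 0)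
    (K₁ : Type) [Field K₁] [NumberField K₁] (hIQ₁ : IsImaginaryQuadratic K₁) (hodd₁ : Odd (NumberField.discr K₁))
    (h3₁ : NumberField.discr K₁ ≠ -3) (hHe₁ : SatisfiesHeegnerHypothesis (W.conductorNorm ℤ) K₁)
    (hsq1₁ : ¬ IsSquare ((NumberField.discr K₁ : ℚ) * -|W.Δ|)) (hsq2₁ : ¬ IsSquare ((NumberField.discr K₁ : ℚ) * (-(2 * |W.Δ|))))
    (ℓ₁ : ℕ) (hℓ₁ : ℓ₁.Prime) (hdK₁ : NumberField.discr K₁ = -(ℓ₁ : ℤ))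
    (h2K₁ : ((Ideal.span {(2 : ℤ)}).primesOver (𝓞 K₁)).ncard = 2)
    (β₁ : ℤ) (ι₁ : K₁ →+* ℂ) (d₁ : KolyvaginHeegnerData Dt β₁ ι₁ 1) (hy₁ : ¬ IsOfFinAddOrder d₁.derivedPoint)
    (M₁ : ℕ) (hdiv₁ : ∃ Q : (W.baseChange (ringClassField K₁ ι₁ 1)).toAffine.Point, ((2 ^ M₁ : ℕ) : ℤ) • Q = d₁.derivedPoint)
    (hndiv₁ : ¬ ∃ Q : (W.baseChange (ringClassField K₁ ι₁ 1)).toAffine.Point, ((2 ^ (M₁ + 1) : ℕ) : ℤ) • Q = d₁.derivedPoint)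
    (hM₁ : 1 ≤ M₁)
    (Wd₁ : WeierstrassCurve ℚ) [Wd₁.IsElliptic] [Wd₁.IsGloballyMinimal]
    (hWd₁ : ∃ C : VariableChange ℚ, C • W.quadraticTwist (NumberField.discr K₁ : ℚ) = Wd₁)
    (hrd₁ : Wd₁.analyticRank = 1) (hSel₁ : Nat.card (Wd₁.selmerGroup 2) = 2) (hDEF₁ : padicValNat 2 Wd₁.tamagawaProduct = 0) :
    M₀ = M₁ := by
  obtain ⟨Kz, _iF, _iN, hIQz, hoddz, h3z, hHez, hsq1z, hsq2z, ℓz, hℓz, hdKz, h2Kz, Wdz, _iE, _iG, hWdz, hrdz, hSelz, hDEFz, hUz⟩ :=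
    stub_unitTwinSupply W hcm hr0 hρ hT hpos h4 v h2v hNv hmult
  obtain ⟨q₀, hq₀, hv₀⟩ := (stub_twinTransport W hcm hr0 hρ hT hpos h4 v h2v hNv hmult Kz hIQz hoddz h3z hHez hsq1z hsq2z ℓz hℓz hdKz
    h2Kz Wdz hWdz hrdz hSelz hDEFz K₀ hIQ₀ hodd₀ h3₀ hHe₀ hsq1₀ hsq2₀ ℓ₀ hℓ₀ hdK₀ h2K₀ Wd₀ hWd₀ hrd₀ hSel₀ hDEF₀).mp hUz
  obtain ⟨q₁, hq₁, hv₁⟩ := (stub_twinTransport W hcm hr0 hρ hT hpos h4 v h2v hNv hmult Kz hIQz hoddz h3z hHez hsq1z hsq2z ℓz hℓz hdKz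
    h2Kz Wdz hWdz hrdz hSelz hDEFz K₁ hIQ₁ hodd₁ h3₁ hHe₁ hsq1₁ hsq2₁ ℓ₁ hℓ₁ hdK₁ h2K₁ Wd₁ hWd₁ hrd₁ hSel₁ hDEF₁).mp hUz
  have hLdg := stub_twoFrameLedger hGZ hGZK hL hMi W hcm hr0 hρ hT hpos h4 Dt hopt hc K₀ hIQ₀ hodd₀ h3₀ hHe₀ hsq1₀ hsq2₀ ℓ₀ hℓ₀ hdK₀ h2K₀
    β₀ ι₀ d₀ hy₀ M₀ hdiv₀ hndiv₀ hM₀ Wd₀ hWd₀ hrd₀ hSel₀ hDEF₀ K₁ hIQ₁ hodd₁ h3₁ hHe₁ hsq1₁ hsq2₁ ℓ₁ hℓ₁ hdK₁ h2K₁ β₁ ι₁ d₁ hy₁ M₁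
    hdiv₁ hndiv₁ hM₁ Wd₁ hWd₁ hrd₁ hSel₁ hDEF₁ q₀ q₁ hq₀ hq₁
  rw [hv₀, hv₁, hDEF₀, hDEF₁] at hLdg
  push_cast at hLdg
  omega

/-- **F4 — THE OFF-CUT RESIDUAL (stub, rank 3).**  K₄⁺ VERBATIM on the curves of the cell with NO odd prime of multiplicative reduction
(every odd bad prime additive), where the LEAD's `ℚ`-currency theorems (which need a multiplicative prime `v ∤ 2` for Q2 / the B2♭ habitat)
are not available.  Honest residual of the line (the habitat of 31767 `OffCutResidualAtTwoR` for the COUNT side; here the SUPPLY side).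
Why it might fail: as K₄⁺ itself (Kolyvagin's conjecture at `2`), on a thinner class. [cite: Kolyvagin1989Izv, Thm. B₂] [cite: WZhang2014, Thm. 1.1 (p ≥ 5)] -/
theorem stub_offCut
    (W : WeierstrassCurve ℚ) [W.IsElliptic] [W.IsGloballyMinimal] [NeZero (W.conductorNorm ℤ)]
    (hcm : ¬ W.HasCM) (hr0 : W.analyticRank = 0) (hρ : ∀ n : ℕ, 0 < n → W.HasSurjectiveModNGaloisRep ((2 : ℤ) ^ n))
    (hT : Odd W.tamagawaProduct) (hpos : 0 < W.Δ)
    (h4 : Nat.card (W.selmerGroup 2) = 4 ∧ ∃ c ∈ (W.kummerSelmerStructure ((2 : ℕ) : ℤ)).selmerGroup,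
      galoisCohomology.localization (W.torsionGaloisModule ((2 : ℕ) : ℤ)) (Sum.inl Rat.infinitePlace) 1 c ≠ 0)
    (hoff : ¬ ∃ v : HeightOneSpectrum (𝓞 ℚ), ((2 : ℕ) : 𝓞 ℚ) ∉ v.asIdeal ∧ ((W.conductorNorm ℤ : ℕ) : 𝓞 ℚ) ∈ v.asIdeal ∧
      W.HasMultiplicativeReductionAt v)
    (K : Type) [Field K] [NumberField K] (hIQ : IsImaginaryQuadratic K) (hodd : Odd (NumberField.discr K))
    (h3 : NumberField.discr K ≠ -3) (hHe : SatisfiesHeegnerHypothesis (W.conductorNorm ℤ) K)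
    (hsq1 : ¬ IsSquare ((NumberField.discr K : ℚ) * -|W.Δ|)) (hsq2 : ¬ IsSquare ((NumberField.discr K : ℚ) * (-(2 * |W.Δ|))))
    (ℓ : ℕ) (hℓ : ℓ.Prime) (hdK : NumberField.discr K = -(ℓ : ℤ))
    (h2K : ((Ideal.span {(2 : ℤ)}).primesOver (𝓞 K)).ncard = 2)
    (Dt : ModularParametrizationData W (W.conductorNorm ℤ))
    (hopt : ∀ z ∈ Dt.L.lattice, ∃ w ∈ periodLattice Dt.f, z = (Dt.c : ℂ) * w) (hc : Odd Dt.c)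
    (β : ℤ) (ι : K →+* ℂ) (d : KolyvaginHeegnerData Dt β ι 1) (hy : ¬ IsOfFinAddOrder d.derivedPoint)
    (M₀ : ℕ) (hdiv : ∃ Q : (W.baseChange (ringClassField K ι 1)).toAffine.Point, ((2 ^ M₀ : ℕ) : ℤ) • Q = d.derivedPoint)
    (hndiv : ¬ ∃ Q : (W.baseChange (ringClassField K ι 1)).toAffine.Point, ((2 ^ (M₀ + 1) : ℕ) : ℤ) • Q = d.derivedPoint)
    (hM : 1 ≤ M₀)
    (Wd : WeierstrassCurve ℚ) [Wd.IsElliptic] [Wd.IsGloballyMinimal]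
    (hWd : ∃ C : VariableChange ℚ, C • W.quadraticTwist (NumberField.discr K : ℚ) = Wd)
    (hrd : Wd.analyticRank = 1) (hSel : Nat.card (Wd.selmerGroup 2) = 2) (hDEF : padicValNat 2 Wd.tamagawaProduct = 0) :
    ∃ (n : ℕ) (d : KolyvaginHeegnerData Dt β ι n), Squarefree n ∧
      (∀ ℓ ∈ n.primeFactors, Zhang2014.IsKolyvaginPrime (W.conductorNorm ℤ) W K 2 ℓ ∧ 2 ≤ Zhang2014.kolyvaginIndex W 2 ℓ ∧
        ∃ (v : HeightOneSpectrum (𝓞 ℚ)) (𝔓 : Ideal (absIntegers (𝓞 ℚ) ℚ)) (h : absoluteGaloisGroup ℚ),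
          ((ℓ : ℕ) : 𝓞 ℚ) ∈ v.asIdeal ∧ 𝔓 ∈ v.primesAbove ∧ IsArithFrobAt (𝓞 ℚ) h 𝔓 ∧ ∃ u : W.geomTorsion ((2 : ℕ) : ℤ), h • u ≠ u) ∧
      ¬ ∃ Q : (W.baseChange (ringClassField K ι n)).toAffine.Point, (2 : ℤ) • Q = d.derivedPoint := by
  sorry


/-! ## §2 LOSSLESSNESS (kernel-checked, mod Q2): K₄⁺ ⟹ F1 and K₄⁺ ⟹ F2 on the cut — the split F1 ∧ F2 ∧ F4 is an EQUIVALENT reformulation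
of K₄⁺, not a weakening with slack: F1 is K₄⁺ read at ONE frame through ★★ (`.mp`), F2 is K₄⁺ read at TWO frames (`4^(M₀) = #Ш(E/ℚ)[2^∞] = 4^(M₁)`). -/

/-- **K₄⁺ ⟹ F1** (take `K₁ := K₀`; ★★ `.mp` turns the witness into the count).  Mod Q2. -/
theorem frameAttainment_of_K4Pos (hQ2 : KolyvaginRelationAtTwo)
    (hK4 : Summit.BirchSwinnertonDyer.BirchSwinnertonDyer.Theses.GenusKolyvaginAtTwo.K4Pos)
    (W : WeierstrassCurve ℚ) [W.IsElliptic] [W.IsGloballyMinimal] [NeZero (W.conductorNorm ℤ)]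
    (hcm : ¬ W.HasCM) (hr0 : W.analyticRank = 0) (hρ : ∀ n : ℕ, 0 < n → W.HasSurjectiveModNGaloisRep ((2 : ℤ) ^ n))
    (hT : Odd W.tamagawaProduct) (hpos : 0 < W.Δ)
    (h4 : Nat.card (W.selmerGroup 2) = 4 ∧ ∃ c ∈ (W.kummerSelmerStructure ((2 : ℕ) : ℤ)).selmerGroup,
      galoisCohomology.localization (W.torsionGaloisModule ((2 : ℕ) : ℤ)) (Sum.inl Rat.infinitePlace) 1 c ≠ 0)
    (v : HeightOneSpectrum (𝓞 ℚ)) (h2v : ((2 : ℕ) : 𝓞 ℚ) ∉ v.asIdeal)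
    (hNv : ((W.conductorNorm ℤ : ℕ) : 𝓞 ℚ) ∈ v.asIdeal) (hmult : W.HasMultiplicativeReductionAt v)
    (K₀ : Type) [Field K₀] [NumberField K₀] (hIQ₀ : IsImaginaryQuadratic K₀) (hodd₀ : Odd (NumberField.discr K₀))
    (h3₀ : NumberField.discr K₀ ≠ -3) (hHe₀ : SatisfiesHeegnerHypothesis (W.conductorNorm ℤ) K₀)
    (hsq1₀ : ¬ IsSquare ((NumberField.discr K₀ : ℚ) * -|W.Δ|)) (hsq2₀ : ¬ IsSquare ((NumberField.discr K₀ : ℚ) * (-(2 * |W.Δ|))))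
    (ℓ₀ : ℕ) (hℓ₀ : ℓ₀.Prime) (hdK₀ : NumberField.discr K₀ = -(ℓ₀ : ℤ))
    (h2K₀ : ((Ideal.span {(2 : ℤ)}).primesOver (𝓞 K₀)).ncard = 2)
    (Dt : ModularParametrizationData W (W.conductorNorm ℤ))
    (hopt : ∀ z ∈ Dt.L.lattice, ∃ w ∈ periodLattice Dt.f, z = (Dt.c : ℂ) * w) (hc : Odd Dt.c)
    (β₀ : ℤ) (ι₀ : K₀ →+* ℂ) (d₀ : KolyvaginHeegnerData Dt β₀ ι₀ 1) (hy₀ : ¬ IsOfFinAddOrder d₀.derivedPoint)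
    (M₀ : ℕ) (hdiv₀ : ∃ Q : (W.baseChange (ringClassField K₀ ι₀ 1)).toAffine.Point, ((2 ^ M₀ : ℕ) : ℤ) • Q = d₀.derivedPoint)
    (hndiv₀ : ¬ ∃ Q : (W.baseChange (ringClassField K₀ ι₀ 1)).toAffine.Point, ((2 ^ (M₀ + 1) : ℕ) : ℤ) • Q = d₀.derivedPoint)
    (hM₀ : 1 ≤ M₀) (hM₀2 : 2 ≤ M₀)
    (Wd₀ : WeierstrassCurve ℚ) [Wd₀.IsElliptic] [Wd₀.IsGloballyMinimal]
    (hWd₀ : ∃ C : VariableChange ℚ, C • W.quadraticTwist (NumberField.discr K₀ : ℚ) = Wd₀)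
    (hrd₀ : Wd₀.analyticRank = 1) (hSel₀ : Nat.card (Wd₀.selmerGroup 2) = 2) (hDEF₀ : padicValNat 2 Wd₀.tamagawaProduct = 0) :
    ∃ (K₁ : Type) (_ : Field K₁) (_ : NumberField K₁),
      IsImaginaryQuadratic K₁ ∧ Odd (NumberField.discr K₁) ∧ NumberField.discr K₁ ≠ -3 ∧
      SatisfiesHeegnerHypothesis (W.conductorNorm ℤ) K₁ ∧
      ¬ IsSquare ((NumberField.discr K₁ : ℚ) * -|W.Δ|) ∧ ¬ IsSquare ((NumberField.discr K₁ : ℚ) * (-(2 * |W.Δ|))) ∧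
      ∃ (ℓ₁ : ℕ), ℓ₁.Prime ∧ NumberField.discr K₁ = -(ℓ₁ : ℤ) ∧ ((Ideal.span {(2 : ℤ)}).primesOver (𝓞 K₁)).ncard = 2 ∧
      ∃ (β₁ : ℤ) (ι₁ : K₁ →+* ℂ) (d₁ : KolyvaginHeegnerData Dt β₁ ι₁ 1), ¬ IsOfFinAddOrder d₁.derivedPoint ∧
      ∃ (M₁ : ℕ), (∃ Q : (W.baseChange (ringClassField K₁ ι₁ 1)).toAffine.Point, ((2 ^ M₁ : ℕ) : ℤ) • Q = d₁.derivedPoint) ∧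
        (¬ ∃ Q : (W.baseChange (ringClassField K₁ ι₁ 1)).toAffine.Point, ((2 ^ (M₁ + 1) : ℕ) : ℤ) • Q = d₁.derivedPoint) ∧ 1 ≤ M₁ ∧
        (∃ (Wd₁ : WeierstrassCurve ℚ) (_ : Wd₁.IsElliptic) (_ : Wd₁.IsGloballyMinimal),
          (∃ C : VariableChange ℚ, C • W.quadraticTwist (NumberField.discr K₁ : ℚ) = Wd₁) ∧ Wd₁.analyticRank = 1 ∧
          Nat.card (Wd₁.selmerGroup 2) = 2 ∧ padicValNat 2 Wd₁.tamagawaProduct = 0) ∧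
        Nat.card (AddCommGroup.primaryComponent (↥W.sha) 2) = 4 ^ M₁ := by
  obtain ⟨σ₀, hσ₀⟩ := exists_algEquiv_ne_one K₀ hIQ₀
  obtain ⟨Cd, hCd⟩ := hWd₀
  have hw := hK4 W hcm hr0 hρ hT hpos h4 K₀ hIQ₀ hodd₀ h3₀ hHe₀ hsq1₀ hsq2₀ ℓ₀ hℓ₀ hdK₀ h2K₀ Dt hopt hc β₀ ι₀ d₀ hy₀ M₀ hdiv₀ hndiv₀
    hM₀ Wd₀ ⟨Cd, hCd⟩ hrd₀ hSel₀ hDEF₀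
  have hY := (kFourPos_witness_iff_natCard_shaPrimary_rat_eq_pow W K₀ hQ2 hcm hT v h2v hNv hmult hpos hIQ₀ hodd₀ h3₀ hHe₀ hsq1₀
    hsq2₀ hρ Dt β₀ ι₀ d₀ hy₀ M₀ hM₀ hdiv₀ hndiv₀ Wd₀ Cd hCd hSel₀ hDEF₀ h4 hr0 h2K₀ hσ₀).mp hw
  exact ⟨K₀, inferInstance, inferInstance, hIQ₀, hodd₀, h3₀, hHe₀, hsq1₀, hsq2₀, ℓ₀, hℓ₀, hdK₀, h2K₀, β₀, ι₀, d₀, hy₀, M₀, hdiv₀,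
    hndiv₀, hM₀, ⟨Wd₀, inferInstance, inferInstance, ⟨Cd, hCd⟩, hrd₀, hSel₀, hDEF₀⟩, hY⟩

/-- **K₄⁺ ⟹ F2** (★★ `.mp` at both frames: `4^(M₀) = #Ш(E/ℚ)[2^∞] = 4^(M₁)`).  Mod Q2. -/
theorem depthRigidity_of_K4Pos (hQ2 : KolyvaginRelationAtTwo)
    (hK4 : Summit.BirchSwinnertonDyer.BirchSwinnertonDyer.Theses.GenusKolyvaginAtTwo.K4Pos)
    (W : WeierstrassCurve ℚ) [W.IsElliptic] [W.IsGloballyMinimal] [NeZero (W.conductorNorm ℤ)]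
    (hcm : ¬ W.HasCM) (hr0 : W.analyticRank = 0) (hρ : ∀ n : ℕ, 0 < n → W.HasSurjectiveModNGaloisRep ((2 : ℤ) ^ n))
    (hT : Odd W.tamagawaProduct) (hpos : 0 < W.Δ)
    (h4 : Nat.card (W.selmerGroup 2) = 4 ∧ ∃ c ∈ (W.kummerSelmerStructure ((2 : ℕ) : ℤ)).selmerGroup,
      galoisCohomology.localization (W.torsionGaloisModule ((2 : ℕ) : ℤ)) (Sum.inl Rat.infinitePlace) 1 c ≠ 0)
    (v : HeightOneSpectrum (𝓞 ℚ)) (h2v : ((2 : ℕ) : 𝓞 ℚ) ∉ v.asIdeal)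
    (hNv : ((W.conductorNorm ℤ : ℕ) : 𝓞 ℚ) ∈ v.asIdeal) (hmult : W.HasMultiplicativeReductionAt v)
    (Dt : ModularParametrizationData W (W.conductorNorm ℤ))
    (hopt : ∀ z ∈ Dt.L.lattice, ∃ w ∈ periodLattice Dt.f, z = (Dt.c : ℂ) * w) (hc : Odd Dt.c)
    (K₀ : Type) [Field K₀] [NumberField K₀] (hIQ₀ : IsImaginaryQuadratic K₀) (hodd₀ : Odd (NumberField.discr K₀))
    (h3₀ : NumberField.discr K₀ ≠ -3) (hHe₀ : SatisfiesHeegnerHypothesis (W.conductorNorm ℤ) K₀)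
    (hsq1₀ : ¬ IsSquare ((NumberField.discr K₀ : ℚ) * -|W.Δ|)) (hsq2₀ : ¬ IsSquare ((NumberField.discr K₀ : ℚ) * (-(2 * |W.Δ|))))
    (ℓ₀ : ℕ) (hℓ₀ : ℓ₀.Prime) (hdK₀ : NumberField.discr K₀ = -(ℓ₀ : ℤ))
    (h2K₀ : ((Ideal.span {(2 : ℤ)}).primesOver (𝓞 K₀)).ncard = 2)
    (β₀ : ℤ) (ι₀ : K₀ →+* ℂ) (d₀ : KolyvaginHeegnerData Dt β₀ ι₀ 1) (hy₀ : ¬ IsOfFinAddOrder d₀.derivedPoint)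
    (M₀ : ℕ) (hdiv₀ : ∃ Q : (W.baseChange (ringClassField K₀ ι₀ 1)).toAffine.Point, ((2 ^ M₀ : ℕ) : ℤ) • Q = d₀.derivedPoint)
    (hndiv₀ : ¬ ∃ Q : (W.baseChange (ringClassField K₀ ι₀ 1)).toAffine.Point, ((2 ^ (M₀ + 1) : ℕ) : ℤ) • Q = d₀.derivedPoint)
    (hM₀ : 1 ≤ M₀) (hM₀2 : 2 ≤ M₀)
    (Wd₀ : WeierstrassCurve ℚ) [Wd₀.IsElliptic] [Wd₀.IsGloballyMinimal]
    (hWd₀ : ∃ C : VariableChange ℚ, C • W.quadraticTwist (NumberField.discr K₀ : ℚ) = Wd₀)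
    (hrd₀ : Wd₀.analyticRank = 1) (hSel₀ : Nat.card (Wd₀.selmerGroup 2) = 2) (hDEF₀ : padicValNat 2 Wd₀.tamagawaProduct = 0)
    (K₁ : Type) [Field K₁] [NumberField K₁] (hIQ₁ : IsImaginaryQuadratic K₁) (hodd₁ : Odd (NumberField.discr K₁))
    (h3₁ : NumberField.discr K₁ ≠ -3) (hHe₁ : SatisfiesHeegnerHypothesis (W.conductorNorm ℤ) K₁)
    (hsq1₁ : ¬ IsSquare ((NumberField.discr K₁ : ℚ) * -|W.Δ|)) (hsq2₁ : ¬ IsSquare ((NumberField.discr K₁ : ℚ) * (-(2 * |W.Δ|))))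
    (ℓ₁ : ℕ) (hℓ₁ : ℓ₁.Prime) (hdK₁ : NumberField.discr K₁ = -(ℓ₁ : ℤ))
    (h2K₁ : ((Ideal.span {(2 : ℤ)}).primesOver (𝓞 K₁)).ncard = 2)
    (β₁ : ℤ) (ι₁ : K₁ →+* ℂ) (d₁ : KolyvaginHeegnerData Dt β₁ ι₁ 1) (hy₁ : ¬ IsOfFinAddOrder d₁.derivedPoint)
    (M₁ : ℕ) (hdiv₁ : ∃ Q : (W.baseChange (ringClassField K₁ ι₁ 1)).toAffine.Point, ((2 ^ M₁ : ℕ) : ℤ) • Q = d₁.derivedPoint)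
    (hndiv₁ : ¬ ∃ Q : (W.baseChange (ringClassField K₁ ι₁ 1)).toAffine.Point, ((2 ^ (M₁ + 1) : ℕ) : ℤ) • Q = d₁.derivedPoint)
    (hM₁ : 1 ≤ M₁)
    (Wd₁ : WeierstrassCurve ℚ) [Wd₁.IsElliptic] [Wd₁.IsGloballyMinimal]
    (hWd₁ : ∃ C : VariableChange ℚ, C • W.quadraticTwist (NumberField.discr K₁ : ℚ) = Wd₁)
    (hrd₁ : Wd₁.analyticRank = 1) (hSel₁ : Nat.card (Wd₁.selmerGroup 2) = 2) (hDEF₁ : padicValNat 2 Wd₁.tamagawaProduct = 0) :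
    M₀ = M₁ := by
  obtain ⟨σ₀, hσ₀⟩ := exists_algEquiv_ne_one K₀ hIQ₀
  obtain ⟨σ₁, hσ₁⟩ := exists_algEquiv_ne_one K₁ hIQ₁
  obtain ⟨C₀, hC₀⟩ := hWd₀
  obtain ⟨C₁, hC₁⟩ := hWd₁
  have hw₀ := hK4 W hcm hr0 hρ hT hpos h4 K₀ hIQ₀ hodd₀ h3₀ hHe₀ hsq1₀ hsq2₀ ℓ₀ hℓ₀ hdK₀ h2K₀ Dt hopt hc β₀ ι₀ d₀ hy₀ M₀ hdiv₀ hndiv₀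
    hM₀ Wd₀ ⟨C₀, hC₀⟩ hrd₀ hSel₀ hDEF₀
  have hw₁ := hK4 W hcm hr0 hρ hT hpos h4 K₁ hIQ₁ hodd₁ h3₁ hHe₁ hsq1₁ hsq2₁ ℓ₁ hℓ₁ hdK₁ h2K₁ Dt hopt hc β₁ ι₁ d₁ hy₁ M₁ hdiv₁ hndiv₁
    hM₁ Wd₁ ⟨C₁, hC₁⟩ hrd₁ hSel₁ hDEF₁
  have hY₀ := (kFourPos_witness_iff_natCard_shaPrimary_rat_eq_pow W K₀ hQ2 hcm hT v h2v hNv hmult hpos hIQ₀ hodd₀ h3₀ hHe₀ hsq1₀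
    hsq2₀ hρ Dt β₀ ι₀ d₀ hy₀ M₀ hM₀ hdiv₀ hndiv₀ Wd₀ C₀ hC₀ hSel₀ hDEF₀ h4 hr0 h2K₀ hσ₀).mp hw₀
  have hY₁ := (kFourPos_witness_iff_natCard_shaPrimary_rat_eq_pow W K₁ hQ2 hcm hT v h2v hNv hmult hpos hIQ₁ hodd₁ h3₁ hHe₁ hsq1₁
    hsq2₁ hρ Dt β₁ ι₁ d₁ hy₁ M₁ hM₁ hdiv₁ hndiv₁ Wd₁ C₁ hC₁ hSel₁ hDEF₁ h4 hr0 h2K₁ hσ₁).mp hw₁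
  exact Nat.pow_right_injective (by norm_num : 2 ≤ 4) (hY₀.symm.trans hY₁)

/-- **COMPOSITION (kernel-checked; no `sorry` of its own): F1 → F2 → F4 → K₄⁺, modulo Q2.**  Off the cut: F4.  On the cut: F1 supplies an
admissible prime frame `K₁` with `#Ш(E/ℚ)[2^∞] = 4^(M₁)`; F2 gives `M₀ = M₁`; the LEAD's ★★ `kFourPos_witness_iff_natCard_shaPrimary_rat_eq_pow`
(mod Q2 only) at the ORIGINAL frame `K`, direction `.mpr`, is the transposition-deep witness.  K4Pos is NOT proved (the stubs are open);
no summit is proved by a line. -/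
theorem K4Pos_of (hQ2 : KolyvaginRelationAtTwo) (hGZ : GrossZagierAllLevels) (hGZK : MultPublishedInputsAtTwo) (hL : EntireLFunctionRat)
    (hMi : MilneAnyModel) :
    Summit.BirchSwinnertonDyer.BirchSwinnertonDyer.Theses.GenusKolyvaginAtTwo.K4Pos := by
  intro W _ _ _ hcm hr0 hρ hT hpos h4 K _ _ hIQ hodd h3 hHe hsq1 hsq2 ℓ₀ hℓ₀ hdK h2K Dt hopt hc β ι d₁ hy M₀ hdiv hndiv hM₀ Wd _ _ hWd
    hrd hSel hDEF
  by_cases hcut : ∃ v : HeightOneSpectrum (𝓞 ℚ), ((2 : ℕ) : 𝓞 ℚ) ∉ v.asIdeal ∧ ((W.conductorNorm ℤ : ℕ) : 𝓞 ℚ) ∈ v.asIdeal ∧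
      W.HasMultiplicativeReductionAt v
  swap
  · exact stub_offCut W hcm hr0 hρ hT hpos h4 hcut K hIQ hodd h3 hHe hsq1 hsq2 ℓ₀ hℓ₀ hdK h2K Dt hopt hc β ι d₁ hy M₀ hdiv hndiv hM₀
      Wd hWd hrd hSel hDEF
  obtain ⟨v, h2v, hNv, hmult⟩ := hcut
  -- depth ONE on the cut: the LEAD's theorem (item 33819 `K4PosDepthOneOnCut`), by name
  by_cases h1 : M₀ = 1
  · exact Summit.BirchSwinnertonDyer.BirchSwinnertonDyer.Theorems.GenusExact.PlusDescent.kFourPos_conclusion_of_depth_one_of_hasMultiplicativeReductionAt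
      hQ2 W hcm hr0 hρ hT hpos h4 v h2v hNv hmult K hIQ hodd h3 hHe hsq1 hsq2 ℓ₀ hℓ₀ hdK h2K Dt hopt hc β ι d₁ hy M₀ hdiv hndiv h1 Wd hWd
      hrd hSel hDEF
  have hM₀2 : 2 ≤ M₀ := by omega
  -- F1: an admissible prime frame `K₁` of `E` whose depth `M₁` attains the `Ш`-exponent
  obtain ⟨K₁, _instF, _instNF, hIQ₁, hodd₁, h3₁, hHe₁, hsq1₁, hsq2₁, ℓ₁, hℓ₁, hdK₁, h2K₁, β₁, ι₁, e₁, hy₁, M₁, hdiv₁, hndiv₁, hM₁,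
      ⟨Wd₁, _instE₁, _instG₁, hWd₁, hrd₁, hSel₁, hDEF₁⟩, hY⟩ :=
    stub_frameAttainment W hcm hr0 hρ hT hpos h4 v h2v hNv hmult K hIQ hodd h3 hHe hsq1 hsq2 ℓ₀ hℓ₀ hdK h2K Dt hopt hc β ι d₁ hy M₀
      hdiv hndiv hM₀ hM₀2 Wd hWd hrd hSel hDEF
  -- F2 (derived from F2T + F2Z + F2L): the depth is rigid across the two frames
  have hMM : M₀ = M₁ :=
    depthRigidity_of_transport hGZ hGZK hL hMi W hcm hr0 hρ hT hpos h4 v h2v hNv hmult Dt hopt hc K hIQ hodd h3 hHe hsq1 hsq2 ℓ₀ hℓ₀ hdK h2K β ι d₁ hy M₀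
      hdiv hndiv hM₀ hM₀2 Wd hWd hrd hSel hDEF K₁ hIQ₁ hodd₁ h3₁ hHe₁ hsq1₁ hsq2₁ ℓ₁ hℓ₁ hdK₁ h2K₁ β₁ ι₁ e₁ hy₁ M₁ hdiv₁ hndiv₁ hM₁
      Wd₁ hWd₁ hrd₁ hSel₁ hDEF₁
  -- a non-trivial automorphism of the quadratic field `K`
  obtain ⟨σ₀, hσ₀⟩ := exists_algEquiv_ne_one K hIQ
  obtain ⟨Cd, hCd⟩ := hWd
  -- ★★ at the original frame, direction (count ⟹ witness)
  exact (kFourPos_witness_iff_natCard_shaPrimary_rat_eq_pow W K hQ2 hcm hT v h2v hNv hmult hpos hIQ hodd h3 hHe hsq1 hsq2 hρ Dt β ι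
    d₁ hy M₀ hM₀ hdiv hndiv Wd Cd hCd hSel hDEF h4 hr0 h2K hσ₀).mpr (by rw [hMM]; exact hY)

end Summit.BirchSwinnertonDyer.BirchSwinnertonDyer.Cruxes.K4Pos.FrameRigidity

end
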